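import Summits.BirchSwinnertonDyer.Rank1Residual.Additive.LocalTowerKernelCardEqTamagawaCyclotomic
import Summits.BirchSwinnertonDyer.Rank1Residual.Additive.AdicIntegersQuotientPrimePowCard
import Literature.NumberTheory.EllipticCurves.LocalKummerMap
import Literature.NumberTheory.EllipticCurves.LocalPointsIntegersSubgroup
import Mathlib.GroupTheory.Torsion
import HarnessLib

/-!
# The level-`p^m` inputs of the count (C) hold for `m ≫ 0`: (kill) at `ℓ ∤ p`, (MW) from a
# rank-one generator, (Ш) from the finiteness of `Ш[p^∞]`, the exact local level along a model
# isomorphism, and `𝒦_{v,0}[p^∞] = 0` where `p ∤ c_v` (cell `b2b-bsdres`, CLASS-CLOSURE lane, class O10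
# — x1b GEN 42, class lead; file 109 of the series: the level choice behind files 107/108)

HONEST FRAMING (cell `b2b-bsdres`, run/shared/lean/b2b/bsd-rank1-residual/, verbatim in every
file): the goal of the cell is to DELETE the COMBINATION-SHAPED residual classes of the
Birch–Swinnerton-Dyer formula for ALL analytic-rank `≤ 1` elliptic curves over `ℚ` — "full BSD
formula for every rank `≤ 1` curve in class `C`" assembled STRICTLY from published theorems — so
that the rank-`≤ 1` remainder becomes exactly the CONSTRUCTION-SHAPED classes, which are TYPED
(missing-input `Prop`s), NOT attempted. This is not "finishing BSD". CLASS-CLOSURE lane: prove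
what is provable now; shrink each hard class to its core with data; no claim beyond stated classes;
research routes on CONSTRUCTION-SHAPED X12 / O10; census / instrument output = EVIDENCE / conjecture
items, NEVER a Literature fact; `RESIDUAL-MAP.md` marks change only by signed lines. THIS FILE:
TOOL THEOREMS ONLY — no definition, no named Literature fact, no Summits-side fact `def … : Prop`,
no `sorry`, axioms standard; UNCONDITIONAL elementary lemmas (group bookkeeping + the tree's
AEC VII.6.3 / B4); nothing is booked; no label / mark / count / sub-cell moves; (C1_η), (C2_η-GZ),
(C3_η) stay typed as filed (cc-typer-6's pen); nothing about `BSD(W, p)` of any pair is claimed.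

## What (the hypotheses of files 100/107/108 that depend on the auxiliary level `m`)

* §1 (kill) **`exists_pow_smul_kummerSelmerStructure_inr_eq_zero`**: at a finite place `w ∤ p` of a
  number field there is `s` with `p^k · 𝓚_w^{(p^m)} = 0` for all `m` and all `k ≥ s`
  (`𝓚_w^{(p^m)} = E(K_w)/p^m`; AEC VII.6.3: a torsion-free finite-index `U ≤ E(K_w)` with
  `[U : p^m U] = #(𝓞_w/p^m) = 1`, so `E(K_w)/p^m` is a quotient of `E(K_w)/U`; `p^s ∥ [E(K_w) : U]`).
* §2 (MW) **`rankOne_level_inputs`**: if `P` has infinite order and generates `G` modulo torsion and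
  `G` has no `p`-torsion, then for every `m`: every `Q` is `a • P` modulo `p^m G`, and
  `a • P ∈ p^m G ⟹ p^m ∣ a`.
* §3 (Ш) **`exists_exponent_of_finite_primaryComponent`**: if `S[p^∞]` is finite there is `e` with
  `p^m c = 0 ⟹ p^e c = 0` for all `c ∈ S`, all `m`.
* §4 (loc) **`exists_nsmul_eq_baseChange_of_algHom`**: `p^n`-divisibility of the image of a rational
  point is transported along a `K`-algebra map of the local model (`Point.map_baseChange`).
* §5 **`localTowerKerPrimary_eq_bot_of_not_dvd_localTamagawaNumber`**: for the cyclotomic tower and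
  `v ∤ p` with `p ∤ c_v`, `𝒦_{v,0}[p^∞] = 0` (B4 for the cyclotomic tower, file 54: `#𝒦_{v,0}[p^∞] =
  p^{ord_p c_v}`).

References: [SilvermanAEC2009] VII.6.3, VIII.§1; [GreenbergLNM1716] §3 Lemma 3.3, §4;
[MilneADT2006] I Lemma 3.3.
-/

noncomputable section

open scoped Classical

open Field Function NumberField IsDedekindDomain WeierstrassCurve
open Literature.NumberTheory.EllipticCurves
open Literature.NumberTheory.GaloisRepresentations
open Summit.BirchSwinnertonDyer.Rank1Residual.Additive.DefectCountFiniteLevel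

namespace Summit.BirchSwinnertonDyer.Rank1Residual.Additive.LevelBridge

universe u

/-! ### §1 (kill): `p^k` kills `E(K_w)/p^m` at `w ∤ p`, uniformly in `m` -/

section Kill

variable {K : Type} [Field K] [NumberField K] (W : WeierstrassCurve K) [W.IsElliptic] {p : ℕ}
  [hp : Fact p.Prime]

/-- **(kill) uniformly in the level.** At a finite place `w ∤ p` there is `s` such that for every
level `p^m` and every `k ≥ s`, `p^k` kills the Kummer group `𝓚_w = im(E(K_w) → H¹(K_w, E[p^m]))`:
with `U ≤ E(K_w)` torsion-free of finite index `N = p^s N'` and `[U : p^m U] = #(𝓞_w/p^m 𝓞_w) = 1`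
(AEC VII.6.3; `w ∤ p`), `p^s P ∈ p^m E(K_w)` for every `P` (`N P ∈ U = p^m U` and `N'` is invertible
modulo `p^{m+1}`), hence `p^k · κ(P) = κ(p^k P) = 0`. [cite: SilvermanAEC2009, Prop. VII.6.3]
[cite: MilneADT2006, I Lemma 3.3] -/
theorem exists_pow_smul_kummerSelmerStructure_inr_eq_zero {w : HeightOneSpectrum (𝓞 K)}
    (hpw : (p : 𝓞 K) ∉ w.asIdeal) :
    ∃ s : ℕ, ∀ m k : ℕ, s ≤ k →
      ∀ x ∈ W.kummerSelmerStructure ((p ^ m : ℕ) : ℤ) (Sum.inr w), p ^ k • x = 0 := by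
  obtain ⟨U, hUfin, -, hUdiv⟩ := W.exists_finiteIndex_torsionFree_adicCompletion (v := w)
  haveI := hUfin
  have hN0 : U.index ≠ 0 := AddSubgroup.FiniteIndex.index_ne_zero
  obtain ⟨s, N', hN', hN⟩ := Nat.exists_eq_pow_mul_and_not_dvd hN0 p hp.out.one_lt.ne'
  refine ⟨s, fun m k hsk x hx ↦ ?_⟩
  haveI : CharZero (w.adicCompletion K) := charZero_adicCompletion w
  have hn0 : (((p ^ m : ℕ) : ℤ)) ≠ 0 := by exact_mod_cast pow_ne_zero m hp.out.ne_zero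
  -- `x = κ(P)` for a point `P ∈ E(K_w)`
  have hx' : x ∈ (W.localKummerMap (w.adicCompletion K) hn0).range := by
    rw [range_localKummerMap]; exact hx
  obtain ⟨P, rfl⟩ := hx'
  suffices h2 : (W.localKummerMap (w.adicCompletion K) hn0) (p ^ k • P) = 0 by
    rw [map_nsmul] at h2; exact h2
  rw [← AddMonoidHom.mem_ker, ker_localKummerMap]
  -- `U = p^m U` (`[U : p^m U] = #(𝓞_w/p^m) = 1`)
  have hU : U ≤ U.map (nsmulAddMonoidHom (p ^ m)) := by
    rw [← AddSubgroup.relIndex_eq_one, hUdiv (p ^ m) (pow_ne_zero m hp.out.ne_zero),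
      natCard_quot_adicCompletionIntegers_natCast_pow w hp.out.ne_zero m,
      WeierstrassCurve.natCard_quot_adicCompletionIntegers_eq_one hpw, one_pow]
  obtain ⟨u, -, hNP⟩ := AddSubgroup.mem_map.mp (hU (U.nsmul_index_mem P))
  rw [nsmulAddMonoidHom_apply] at hNP
  -- `N' c ≡ 1 mod p^(m+1)`
  have hcop : Nat.Coprime N' (p ^ (m + 1)) :=
    (Nat.Coprime.pow_right (m + 1) ((Nat.Prime.coprime_iff_not_dvd hp.out).mpr hN').symm)
  obtain ⟨c, -, hc⟩ := Nat.exists_mul_mod_eq_one_of_coprime hcop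
    (Nat.one_lt_pow (Nat.succ_ne_zero m) hp.out.one_lt)
  obtain ⟨q, hq⟩ : ∃ q : ℕ, N' * c = p ^ (m + 1) * q + 1 :=
    ⟨N' * c / p ^ (m + 1), by
      have h := Nat.div_add_mod (N' * c) (p ^ (m + 1))
      rw [hc] at h
      exact h.symm⟩
  have hq' : (N' : ℤ) * c = (p : ℤ) ^ (m + 1) * q + 1 := by exact_mod_cast hq
  -- `p^s P = p^m • y`
  have hNP' : ((p ^ m : ℕ) : ℤ) • u = (U.index : ℤ) • P := by
    rw [natCast_zsmul, natCast_zsmul]; exact hNP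
  have key : ((p ^ m : ℕ) : ℤ) • ((c : ℤ) • u - ((p * q * p ^ s : ℕ) : ℤ) • P) =
      ((p ^ s : ℕ) : ℤ) • P := by
    rw [smul_sub, smul_comm, hNP', smul_smul, smul_smul, ← sub_smul]
    congr 1
    rw [hN]
    push_cast
    linear_combination ((p : ℤ) ^ s) * hq'
  refine ⟨p ^ (k - s) • ((c : ℤ) • u - ((p * q * p ^ s : ℕ) : ℤ) • P), ?_⟩
  change ((p ^ m : ℕ) : ℤ) • _ = p ^ k • P
  rw [smul_comm, key, natCast_zsmul, ← mul_nsmul', ← pow_add, Nat.sub_add_cancel hsk]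

end Kill

/-! ### §2 (MW): the level-`p^m` Mordell–Weil inputs from a rank-one generator -/

section MordellWeil

variable {G : Type*} [AddCommGroup G] {p : ℕ} [hp : Fact p.Prime]

/-- **(MW) at every level from a rank-one generator.** If `P` has infinite order, every element of
`G` is `k • P` plus a torsion element, and `G` has no `p`-torsion, then for every `m`: (i) every `Q`
is congruent to a multiple of `P` modulo `p^m G` (a torsion element of order `M` prime to `p` is
`p^m`-divisible: `T = −p^m (p q T)` for `M c = p^{m+1} q + 1`); (ii) `a • P ∈ p^m G ⟹ p^m ∣ a`
(`(a − p^m k) • P` torsion forces `a = p^m k`). [cite: SilvermanAEC2009, VIII.§1]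
[cite: GreenbergLNM1716, §4 (pp. 98–103)] -/
theorem rankOne_level_inputs {P : G} (hP : ¬ IsOfFinAddOrder P)
    (hgen : ∀ R : G, ∃ (k : ℤ) (T : G), IsOfFinAddOrder T ∧ R = k • P + T)
    (htors : ∀ T : G, p • T = 0 → T = 0) (m : ℕ) :
    (∀ Q : G, ∃ a : ℤ, Q - a • P ∈ (zsmulAddGroupHom ((p ^ m : ℕ) : ℤ) : G →+ G).range) ∧
    (∀ a : ℤ, a • P ∈ (zsmulAddGroupHom ((p ^ m : ℕ) : ℤ) : G →+ G).range → ((p ^ m : ℕ) : ℤ) ∣ a) := by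
  refine ⟨fun Q ↦ ?_, fun a ha ↦ ?_⟩
  · obtain ⟨k, T, hT, rfl⟩ := hgen Q
    refine ⟨k, ?_⟩
    rw [add_sub_cancel_left]
    -- `addOrderOf T = p^a * M`, `p ∤ M`, and `M • T = 0`
    obtain ⟨a, M, hM, hNM⟩ :=
      Nat.exists_eq_pow_mul_and_not_dvd hT.addOrderOf_pos.ne' p hp.out.one_lt.ne'
    have hMT : M • T = 0 := by
      refine StrictSha.eq_zero_of_pow_nsmul_eq_zero htors (b := a) ?_
      rw [smul_smul, ← hNM]
      exact addOrderOf_nsmul_eq_zero T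
    have hcop : Nat.Coprime M (p ^ (m + 1)) :=
      (Nat.Coprime.pow_right (m + 1) ((Nat.Prime.coprime_iff_not_dvd hp.out).mpr hM).symm)
    obtain ⟨c, -, hc⟩ := Nat.exists_mul_mod_eq_one_of_coprime hcop
      (Nat.one_lt_pow (Nat.succ_ne_zero m) hp.out.one_lt)
    have h := Nat.div_add_mod (M * c) (p ^ (m + 1))
    rw [hc] at h
    -- `T = (M c) • T - p^{m+1} q • T = - p^m • (p q • T)`
    refine ⟨-(((p * (M * c / p ^ (m + 1)) : ℕ) : ℤ) • T), ?_⟩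
    change ((p ^ m : ℕ) : ℤ) • _ = T
    have h3 : (M * c) • T = p ^ (m + 1) • ((M * c / p ^ (m + 1)) • T) + T := by
      conv_lhs => rw [← h]
      rw [add_smul, one_smul, mul_smul]
    rw [show (M * c) • T = c • (M • T) by rw [mul_comm, mul_smul], hMT, smul_zero] at h3
    have hT1 : T = -(p ^ (m + 1) • ((M * c / p ^ (m + 1)) • T)) := eq_neg_of_add_eq_zero_right h3.symm
    conv_rhs => rw [hT1]
    rw [smul_neg, natCast_zsmul, natCast_zsmul, smul_smul, smul_smul, pow_succ, mul_assoc]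
  · obtain ⟨R, hR⟩ := ha
    obtain ⟨k, T, hT, rfl⟩ := hgen R
    change ((p ^ m : ℕ) : ℤ) • (k • P + T) = a • P at hR
    -- `(a - p^m k) • P = p^m • T` is torsion
    have h1 : (a - ((p ^ m : ℕ) : ℤ) * k) • P = ((p ^ m : ℕ) : ℤ) • T := by
      rw [sub_smul, ← hR, smul_add, mul_smul]; abel
    have hfin : IsOfFinAddOrder ((a - ((p ^ m : ℕ) : ℤ) * k) • P) := by
      rw [h1]; exact hT.zsmul
    by_cases hak : a - ((p ^ m : ℕ) : ℤ) * k = 0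
    · exact ⟨k, by rw [sub_eq_zero] at hak; rw [hak]⟩
    · exfalso
      apply hP
      obtain ⟨n, hn, hn0⟩ := (isOfFinAddOrder_iff_zsmul_eq_zero).mp hfin
      rw [smul_smul] at hn0
      exact (isOfFinAddOrder_iff_zsmul_eq_zero).mpr ⟨n * (a - ((p ^ m : ℕ) : ℤ) * k),
        mul_ne_zero hn hak, hn0⟩

end MordellWeil

/-! ### §3 (Ш): a uniform exponent from the finiteness of the `p`-primary part -/

section Sha

variable {G : Type*} [AddCommGroup G] {p : ℕ} [hp : Fact p.Prime]

/-- **(Ш) uniformly in the level.** If the `p`-primary part of a subgroup `S` is finite of order `N`,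
then `p^m c = 0 ⟹ p^N c = 0` for every `c ∈ S` and every `m` (the order `p^j` of `c` divides `N`,
so `j < p^j ≤ N`). [cite: MilneADT2006, I §6 (finiteness of Ш[p^∞] in use)] -/
theorem exists_exponent_of_finite_primaryComponent (S : AddSubgroup G)
    (hfin : Finite (AddCommGroup.primaryComponent S p)) :
    ∃ e : ℕ, ∀ c ∈ S, ∀ m : ℕ, ((p ^ m : ℕ) : ℤ) • c = 0 → p ^ e • c = 0 := by
  refine ⟨Nat.card (AddCommGroup.primaryComponent S p), fun c hc m hmc ↦ ?_⟩
  set N := Nat.card (AddCommGroup.primaryComponent S p) with hNdef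
  have hmc' : p ^ m • (⟨c, hc⟩ : S) = 0 := by
    apply Subtype.ext
    rw [AddSubmonoidClass.coe_nsmul, ZeroMemClass.coe_zero, ← natCast_zsmul]
    exact hmc
  have hmem : (⟨c, hc⟩ : S) ∈ AddCommGroup.primaryComponent S p :=
    (AddCommGroup.mem_primaryComponent).mpr ⟨m, hmc'⟩
  set x : AddCommGroup.primaryComponent S p := ⟨⟨c, hc⟩, hmem⟩ with hx
  -- `addOrderOf x = p^j ∣ N`, so `j ≤ N`
  have hdvd : addOrderOf x ∣ p ^ m := addOrderOf_dvd_iff_nsmul_eq_zero.mpr (Subtype.ext hmc')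
  obtain ⟨j, -, hj⟩ := (Nat.dvd_prime_pow hp.out).mp hdvd
  have hjN : p ^ j ∣ N := hj ▸ addOrderOf_dvd_natCard x
  have hNpos : 0 < N := Nat.card_pos
  have hjle : j ≤ N := (Nat.lt_pow_self hp.out.one_lt).le.trans (Nat.le_of_dvd hNpos hjN)
  have hx0 : p ^ N • x = 0 := by
    obtain ⟨t, ht⟩ := Nat.exists_eq_add_of_le hjle
    rw [ht, pow_add, mul_comm, mul_nsmul', ← hj, addOrderOf_nsmul_eq_zero, nsmul_zero]
  have h := congrArg (fun y : AddCommGroup.primaryComponent S p ↦ ((y : S) : G)) hx0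
  simpa using h

end Sha

/-! ### §4 (loc): the exact local level along a map of models -/

section Loc

variable {K : Type u} [Field K] (W : WeierstrassCurve K) (F F' : Type u) [Field F] [Field F']
  [Algebra K F] [Algebra K F']

/-- **`p^n`-divisibility of a rational point is transported along a `K`-algebra map of models**
(`Point.map f (P ⊗ F) = P ⊗ F'`, Mathlib `map_baseChange`). With `f` and `f⁻¹` for an isomorphism
`ℚ_[p] ≃ ℚ_{v₀}` this converts the exact level of the typed inputs (`W.toPadicPoint p`) into the one
of the count (C) at `ℚ_{v₀}`. [cite: SilvermanAEC2009, VIII.§1] -/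
theorem exists_nsmul_eq_baseChange_of_algHom (f : F →ₐ[K] F') (P : W.toAffine.Point) (n : ℕ)
    (h : ∃ Q : (W.baseChange F).toAffine.Point, n • Q = Affine.Point.baseChange (W' := W) K F P) :
    ∃ Q' : (W.baseChange F').toAffine.Point, n • Q' = Affine.Point.baseChange (W' := W) K F' P := by
  obtain ⟨Q, hQ⟩ := h
  refine ⟨Affine.Point.map (W' := W) f Q, ?_⟩
  rw [← map_nsmul, hQ, Affine.Point.map_baseChange]

end Loc

/-! ### §5 `𝒦_{v,0}[p^∞] = 0` at `v ∤ p` with `p ∤ c_v`, cyclotomic tower -/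

section TowerKer

variable {K : Type} [Field K] [NumberField K] (W : WeierstrassCurve K) [W.IsElliptic] {p : ℕ}
  [hp : Fact p.Prime] {κ : ZpExtension K p}

/-- **`𝒦_{v,0}[p^∞] = 0` at a finite place `v ∤ p` with `p ∤ c_v`**, for the cyclotomic
`ℤ_p`-extension: B4 for the cyclotomic tower (file 54, `#𝒦_{v,0}[p^∞] = p^{ord_p c_v}`, no finite
place splits completely) with `ord_p c_v = 0` — the hypothesis `hT0` of the count (C) off the places
where `p ∣ c_v`. [cite: GreenbergLNM1716, §3 Lemma 3.3 (pp. 86–88)] -/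
theorem localTowerKerPrimary_eq_bot_of_not_dvd_localTamagawaNumber (hκ : κ.IsCyclotomic)
    {v : HeightOneSpectrum (𝓞 K)} (hpv : (p : 𝓞 K) ∉ v.asIdeal)
    (hc : ¬ p ∣ (W.baseChange (v.adicCompletion K)).localTamagawaNumber (v.adicCompletionIntegers K)) :
    W.localTowerKerPrimary κ (v.adicCompletion K) 0 = ⊥ := by
  apply AddSubgroup.eq_bot_of_card_eq
  rw [natCard_localTowerKerPrimary_zero_eq_pow_of_isCyclotomic W hκ hpv,
    padicValNat.eq_zero_of_not_dvd hc, pow_zero]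

end TowerKer

end Summit.BirchSwinnertonDyer.Rank1Residual.Additive.LevelBridge

end
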